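import Summits.BirchSwinnertonDyer.BirchSwinnertonDyer.Theorems.ShaPrimaryTransferFiniteShaComponentTransferBaseChange
import Summits.BirchSwinnertonDyer.BirchSwinnertonDyer.Theorems.ShaPrimaryTransferFiniteShaComponentTransferOddDoor
import Literature.NumberTheory.EllipticCurves.ShaRestrictionIndex
import HarnessLib

/-!
# BirchSwinnertonDyer / ShaPrimaryTransfer — crux `FiniteShaComponentTransfer` (stmt-BirchSwinnertonDyer-22356):
# THE ODD DOOR OVER A NUMBER FIELD, read over `ℚ` — descent defects up and down a base change

Helper file of prover seat `bsd-line-spt-p1` g14 (`--supports stmt-22356 --as helper`). THEOREMS ONLY (no definition,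
no named fact, no `sorry`, no instance). It composes two tree files of this seat: `…BaseChange` (g14: `t_p(E/K) ≤ t_p(E_L/L)`
along every finite extension; `t_p(E_K) = t_p(E) + t_p(E^{(d_K)})` over a quadratic field, every prime `p`) and `…OddDoor`
(g13: `#Ш(E/K)[p] = p^{t_p + 2m}` unconditionally over every number field, Cassels–Tate being a tree theorem; a NON-SQUARE
`p`-descent defect certifies `t_p ≥ 1`). The route's instruments run descents over number fields (Heegner fields, fields
of definition of isogeny kernels); this file says what such a descent certifies about the `ℚ`-coranks `t_p(E)`,
`t_p(E^{(d)})` that T = `FiniteShaComponentTransfer` speaks about: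

* §1 (any finite extension `L/K`): a non-square `p`-descent defect over `K` makes `Ш(E_L/L)[p^∞]` infinite for EVERY finite
  `L/K` (`infinite_shaPrimary_baseChange_of_not_isSquare`); a closed door upstairs squares the defect downstairs
  (`isSquare_natCard_sha_torsionBy_of_shaCorank_baseChange_eq_zero`).
* §2 (`K/ℚ` quadratic): a non-square `#Ш(E_K)[p]` certifies `t_p(E) ≥ 1 ∨ t_p(E^{(d_K)}) ≥ 1` — an infinite `Ш` over `ℚ` for
  the curve or its twist (`one_le_shaCorank_or_of_not_isSquare_baseChange`); with the `ℚ`-door of `E` closed at `p` the twist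
  is the culprit; two closed `ℚ`-doors at `p` square `#Ш(E_K)[p]`.
* §3 (orders, `L/K` Galois, `n` prime to `[L : K]`): `#Ш(E/K)[n] ≤ #Ш(E_L/L)[n]` (`natCard_sha_torsionBy_le_baseChange`;
  restriction is injective on `Ш[n]`, tree `injOn_shaRestriction_torsionBy`, Serre I.2.4 / Matsuno 2009 Prop. 5.7), so a
  complete `n`-descent upstairs with `Ш(E_L)[n] = 0` gives `Ш(E/K)[n] = 0` downstairs.
* §4 route readings: granting T, one closed door of `E` and one of `E^{(d_K)}` (at possibly DIFFERENT primes) square every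
  descent defect of `E_K` (`isSquare_natCard_sha_torsionBy_baseChange_of_transfer`); **T's kill shape may be run on ONE
  base-changed curve over a quadratic field**: a closed door `t_p(E_K) = 0` together with a non-square `#Ш(E_K)[q]` refutes T
  (`not_finiteShaComponentTransfer_of_baseChange_witness`) — as over `ℚ`, it never fires under the `p`-parity theorem.

Nothing here proves T, O or BSD; T stays conjecture-grade at analytic rank ≥ 2.

## References

* J. W. S. Cassels, Arithmetic on curves of genus 1. IV, J. reine angew. Math. 211 (1962), Thm. 1.1. [Cassels1962ArithmeticIV]
* H. Darmon, *Rational points on modular elliptic curves*, CBMS 101 (2004), §3.9, Exercise 3.18. [Darmon2004]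
* T. Dokchitser, Notes on the parity conjecture, Birkhäuser (2013), §2, §4. [Dokchitser2013ParityNotes]
* K. Matsuno, Elliptic curves with large Tate–Shafarevich groups over a number field, Math. Res. Lett. 16 (2009), Prop. 5.7.
  [Matsuno2009]
* J.-P. Serre, *Galois Cohomology* (1997), I.§2.4. [SerreGaloisCohomology1997]
-/

-- D-0017: single-problem summit, so `Summit.BirchSwinnertonDyer.BirchSwinnertonDyer.…` repeats a namespace BY DESIGN.
set_option linter.dupNamespace false
set_option autoImplicit false

noncomputable section

open scoped Classical
open scoped AddSubgroup
open Literature.NumberTheory.EllipticCurves WeierstrassCurve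
open Summit.BirchSwinnertonDyer.BirchSwinnertonDyer.Theses.ShaPrimaryTransfer
open Summit.BirchSwinnertonDyer.BirchSwinnertonDyer.Theorems.ShaPrimaryTransferBaseChange
open Summit.BirchSwinnertonDyer.BirchSwinnertonDyer.Theorems.ShaPrimaryTransferOddDoor

namespace Summit.BirchSwinnertonDyer.BirchSwinnertonDyer.Theorems.ShaPrimaryTransferBaseChangeOddDoor

/-! ## §1 Any finite extension: a non-square defect downstairs is an infinite `Ш[p^∞]` everywhere upstairs -/

section AnyExtension

variable {K : Type} [Field K] [NumberField K] (W : WeierstrassCurve K) [W.IsElliptic]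
  (L : Type) [Field L] [NumberField L] [Algebra K L] (p : ℕ) [hp : Fact p.Prime]

/-- **A non-square `p`-descent defect over `K` makes `Ш(E_L/L)[p^∞]` infinite for every finite extension `L/K`**:
`#Ш(E/K)[p]` not a square ⟹ `t_p(E/K) ≥ 1` (the odd door, Cassels–Tate) ⟹ `t_p(E_L/L) ≥ 1` (coranks do not drop under
base change). [cite: Cassels1962ArithmeticIV, Thm. 1.1] [cite: Darmon2004, Exercise 3.18] -/
theorem infinite_shaPrimary_baseChange_of_not_isSquare (h : ¬ IsSquare (Nat.card (W.sha[(p : ℤ)]))) :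
    Infinite ↥(AddCommGroup.primaryComponent (W.baseChange L).sha p) :=
  infinite_shaPrimary_baseChange_of_infinite W L p (infinite_shaPrimary_of_not_isSquare W p h)

/-- Corank form: `#Ш(E/K)[p]` not a square ⟹ `1 ≤ t_p(E_L/L)` for every finite `L/K`.
[cite: Cassels1962ArithmeticIV, Thm. 1.1] [cite: Darmon2004, Exercise 3.18] -/
theorem one_le_shaCorank_baseChange_of_not_isSquare (h : ¬ IsSquare (Nat.card (W.sha[(p : ℤ)]))) :
    1 ≤ (W.baseChange L).shaCorank p :=
  one_le_shaCorank_baseChange_of_one_le W L p (one_le_shaCorank_of_not_isSquare W p h)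

/-- **A closed door upstairs squares the defect downstairs**: `t_p(E_L/L) = 0 ⟹ #Ш(E/K)[p]` is a perfect square (and so is
`#Ш(E_L/L)[p]`). [cite: Cassels1962ArithmeticIV, Thm. 1.1] [cite: Darmon2004, Exercise 3.18] -/
theorem isSquare_natCard_sha_torsionBy_of_shaCorank_baseChange_eq_zero (h0 : (W.baseChange L).shaCorank p = 0) :
    IsSquare (Nat.card (W.sha[(p : ℤ)])) :=
  isSquare_natCard_sha_torsionBy_of_shaCorank_eq_zero W p (shaCorank_eq_zero_of_baseChange W L p h0)

/-- Both defects are squares behind a closed door upstairs. [cite: Cassels1962ArithmeticIV, Thm. 1.1] -/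
theorem isSquare_natCard_sha_torsionBy_and_of_shaCorank_baseChange_eq_zero
    (h0 : (W.baseChange L).shaCorank p = 0) :
    IsSquare (Nat.card (W.sha[(p : ℤ)])) ∧ IsSquare (Nat.card ((W.baseChange L).sha[(p : ℤ)])) := by
  haveI : (W.baseChange L).IsElliptic := by rw [WeierstrassCurve.baseChange]; infer_instance
  exact ⟨isSquare_natCard_sha_torsionBy_of_shaCorank_baseChange_eq_zero W L p h0,
    isSquare_natCard_sha_torsionBy_of_shaCorank_eq_zero (W.baseChange L) p h0⟩

end AnyExtension

/-! ## §2 A quadratic field: a non-square `#Ш(E_K)[p]` is an infinite `Ш` over `ℚ` for the curve or its twist -/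

section Quadratic

variable (W : WeierstrassCurve ℚ) [W.IsElliptic] (K : Type) [Field K] [NumberField K]
  (p : ℕ) [hp : Fact p.Prime]

/-- **Two closed `ℚ`-doors at `p` square the defect over `K`**: `t_p(E) = 0` and `t_p(E^{(d_K)}) = 0` ⟹ `#Ш(E_K)[p]` is a
perfect square (`t_p(E_K) = t_p(E) + t_p(E^{(d_K)}) = 0` and the odd door over `K`).
[cite: Dokchitser2013ParityNotes, §2 and §4] [cite: Cassels1962ArithmeticIV, Thm. 1.1] -/
theorem isSquare_natCard_sha_torsionBy_baseChange_of_doors (h2 : Module.finrank ℚ K = 2) (hE : W.shaCorank p = 0)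
    (hEd : (W.quadraticTwist (NumberField.discr K : ℚ)).shaCorank p = 0) :
    IsSquare (Nat.card ((W.baseChange K).sha[(p : ℤ)])) := by
  haveI : (W.baseChange K).IsElliptic := by rw [WeierstrassCurve.baseChange]; infer_instance
  exact isSquare_natCard_sha_torsionBy_of_shaCorank_eq_zero (W.baseChange K) p
    ((shaCorank_baseChange_eq_zero_iff W K p h2).mpr ⟨hE, hEd⟩)

/-- **THE ODD DOOR OVER `K`, READ OVER `ℚ`**: if `#Ш(E_K)[p]` is NOT a perfect square (`K` quadratic) then
`t_p(E) ≥ 1` or `t_p(E^{(d_K)}) ≥ 1` — `Ш(E/ℚ)[p^∞]` or `Ш(E^{(d_K)}/ℚ)[p^∞]` is infinite.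
[cite: Dokchitser2013ParityNotes, §2 and §4] [cite: Cassels1962ArithmeticIV, Thm. 1.1] -/
theorem one_le_shaCorank_or_of_not_isSquare_baseChange (h2 : Module.finrank ℚ K = 2)
    (h : ¬ IsSquare (Nat.card ((W.baseChange K).sha[(p : ℤ)]))) :
    1 ≤ W.shaCorank p ∨ 1 ≤ (W.quadraticTwist (NumberField.discr K : ℚ)).shaCorank p := by
  haveI : (W.baseChange K).IsElliptic := by rw [WeierstrassCurve.baseChange]; infer_instance
  exact (one_le_shaCorank_baseChange_iff W K p h2).mp (one_le_shaCorank_of_not_isSquare (W.baseChange K) p h)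

/-- Group form: a non-square `#Ш(E_K)[p]` ⟹ `Ш(E/ℚ)[p^∞]` or `Ш(E^{(d_K)}/ℚ)[p^∞]` is INFINITE.
[cite: Dokchitser2013ParityNotes, §2 and §4] [cite: Cassels1962ArithmeticIV, Thm. 1.1] -/
theorem infinite_shaPrimary_or_of_not_isSquare_baseChange (h2 : Module.finrank ℚ K = 2)
    (h : ¬ IsSquare (Nat.card ((W.baseChange K).sha[(p : ℤ)]))) :
    Infinite ↥(AddCommGroup.primaryComponent W.sha p) ∨
      Infinite ↥(AddCommGroup.primaryComponent (W.quadraticTwist (NumberField.discr K : ℚ)).sha p) := by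
  have hd : ((NumberField.discr K : ℤ) : ℚ) ≠ 0 := by exact_mod_cast NumberField.discr_ne_zero K
  haveI : (W.quadraticTwist (NumberField.discr K : ℚ)).IsElliptic := W.isElliptic_quadraticTwist hd
  rcases one_le_shaCorank_or_of_not_isSquare_baseChange W K p h2 h with h1 | h1
  · left
    rw [← not_finite_iff_infinite, finite_primaryComponent_sha_iff_shaCorank_eq_zero]
    omega
  · right
    rw [← not_finite_iff_infinite, finite_primaryComponent_sha_iff_shaCorank_eq_zero]
    omega

/-- **With the `ℚ`-door of `E` closed, the twist is the culprit**: `t_p(E) = 0` and `#Ш(E_K)[p]` non-square ⟹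
`t_p(E^{(d_K)}) ≥ 1`. [cite: Dokchitser2013ParityNotes, §2 and §4] -/
theorem one_le_shaCorank_quadraticTwist_of_door_of_not_isSquare_baseChange (h2 : Module.finrank ℚ K = 2)
    (hE : W.shaCorank p = 0) (h : ¬ IsSquare (Nat.card ((W.baseChange K).sha[(p : ℤ)]))) :
    1 ≤ (W.quadraticTwist (NumberField.discr K : ℚ)).shaCorank p := by
  rcases one_le_shaCorank_or_of_not_isSquare_baseChange W K p h2 h with h1 | h1
  · omega
  · exact h1

/-- Symmetrically: `t_p(E^{(d_K)}) = 0` and `#Ш(E_K)[p]` non-square ⟹ `t_p(E) ≥ 1`.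
[cite: Dokchitser2013ParityNotes, §2 and §4] -/
theorem one_le_shaCorank_of_twist_door_of_not_isSquare_baseChange (h2 : Module.finrank ℚ K = 2)
    (hEd : (W.quadraticTwist (NumberField.discr K : ℚ)).shaCorank p = 0)
    (h : ¬ IsSquare (Nat.card ((W.baseChange K).sha[(p : ℤ)]))) : 1 ≤ W.shaCorank p := by
  rcases one_le_shaCorank_or_of_not_isSquare_baseChange W K p h2 h with h1 | h1
  · exact h1
  · omega

/-- **The defect over `K` is a square iff the two `ℚ`-coranks have the same parity**: `#Ш(E_K)[p]` square ⟺
`(t_p(E)` even ⟺ `t_p(E^{(d_K)})` even`)`. [cite: Dokchitser2013ParityNotes, §2 and §4] -/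
theorem isSquare_natCard_sha_torsionBy_baseChange_iff (h2 : Module.finrank ℚ K = 2) :
    IsSquare (Nat.card ((W.baseChange K).sha[(p : ℤ)])) ↔
      (Even (W.shaCorank p) ↔ Even ((W.quadraticTwist (NumberField.discr K : ℚ)).shaCorank p)) := by
  haveI : (W.baseChange K).IsElliptic := by rw [WeierstrassCurve.baseChange]; infer_instance
  rw [isSquare_natCard_sha_torsionBy_iff_even_shaCorank (W.baseChange K) p]
  exact even_shaCorank_baseChange_iff W K p h2

end Quadratic

/-! ## §3 Orders: `#Ш(E/K)[n] ≤ #Ш(E_L/L)[n]` for `L/K` Galois of degree prime to `n` -/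

section Orders

variable {K : Type} [Field K] [NumberField K] (W : WeierstrassCurve K) [W.IsElliptic]
  (L : Type) [Field L] [NumberField L] [Algebra K L]

/-- **`#Ш(E/K)[n] ≤ #Ш(E_L/L)[n]` for `L/K` Galois and `n ≥ 1` prime to `[L : K]`**: restriction `Ш(E/K) → Ш(E_L/L)` is
injective on `Ш[n]` (`cor ∘ res = [L : K]` kills the kernel, tree `injOn_shaRestriction_torsionBy`) and maps `Ш[n]` into
`Ш[n]`, which is finite upstairs (Silverman X.4.2(b)). [cite: SerreGaloisCohomology1997, I.§2.4 Cor. to Prop. 9]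
[cite: Matsuno2009, proof of Prop. 5.7] -/
theorem natCard_sha_torsionBy_le_baseChange [IsGalois K L] {n : ℕ} (hn0 : n ≠ 0)
    (hn : n.Coprime (Module.finrank K L)) :
    Nat.card (W.sha[(n : ℤ)]) ≤ Nat.card ((W.baseChange L).sha[(n : ℤ)]) := by
  haveI : (W.baseChange L).IsElliptic := by rw [WeierstrassCurve.baseChange]; infer_instance
  have hn0' : ((n : ℕ) : ℤ) ≠ 0 := by exact_mod_cast hn0
  haveI : Finite (((W.baseChange L).sha)[(n : ℤ)]) := (W.baseChange L).finite_sha_torsionBy_holds (n : ℤ) hn0'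
  have hmem : ∀ x : W.sha[(n : ℤ)], shaRestriction W L (x : W.sha) ∈ ((W.baseChange L).sha)[(n : ℤ)] := fun x ↦ by
    rw [AddSubgroup.torsionBy.nsmul_iff, ← map_nsmul]
    have hx : n • (x : W.sha) = 0 := by
      rw [← AddSubgroupClass.coe_nsmul, AddSubgroup.torsionBy.nsmul x, ZeroMemClass.coe_zero]
    rw [hx, map_zero]
  refine Nat.card_le_card_of_injective (fun x ↦ (⟨shaRestriction W L (x : W.sha), hmem x⟩ :
    ((W.baseChange L).sha)[(n : ℤ)])) fun x y hxy ↦ ?_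
  have h := congrArg (fun z : ((W.baseChange L).sha)[(n : ℤ)] ↦ (z : (W.baseChange L).sha)) hxy
  exact Subtype.ext (injOn_shaRestriction_torsionBy W L hn x.2 y.2 h)

/-- **A complete `n`-descent upstairs closes `Ш[n]` downstairs**: `L/K` Galois, `n ≥ 1` prime to `[L : K]`,
`#Ш(E_L/L)[n] = 1 ⟹ #Ш(E/K)[n] = 1`. [cite: SerreGaloisCohomology1997, I.§2.4 Cor. to Prop. 9]
[cite: Matsuno2009, proof of Prop. 5.7] -/
theorem natCard_sha_torsionBy_eq_one_of_baseChange [IsGalois K L] {n : ℕ} (hn0 : n ≠ 0)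
    (hn : n.Coprime (Module.finrank K L)) (h1 : Nat.card ((W.baseChange L).sha[(n : ℤ)]) = 1) :
    Nat.card (W.sha[(n : ℤ)]) = 1 := by
  have hle := natCard_sha_torsionBy_le_baseChange W L hn0 hn
  have hn0' : ((n : ℕ) : ℤ) ≠ 0 := by exact_mod_cast hn0
  haveI : Finite ((W.sha)[(n : ℤ)]) := W.finite_sha_torsionBy_holds (n : ℤ) hn0'
  have hpos : 0 < Nat.card (W.sha[(n : ℤ)]) := Nat.card_pos
  omega

/-- In the route's currency: `L/K` Galois of degree prime to `p`, `Ш(E_L/L)[p] = 0` (`#= 1`) ⟹ `t_p(E/K) = 0` AND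
`#Ш(E/K)[p] = 1` — the door certified upstairs by a FIRST descent is a closed first descent downstairs.
[cite: SerreGaloisCohomology1997, I.§2.4 Cor. to Prop. 9] [cite: Matsuno2009, proof of Prop. 5.7] -/
theorem shaCorank_eq_zero_and_natCard_eq_one_of_baseChange [IsGalois K L] (p : ℕ) [hp : Fact p.Prime]
    (hpd : p.Coprime (Module.finrank K L)) (h1 : Nat.card ((W.baseChange L).sha[(p : ℤ)]) = 1) :
    W.shaCorank p = 0 ∧ Nat.card (W.sha[(p : ℤ)]) = 1 := by
  have h := natCard_sha_torsionBy_eq_one_of_baseChange W L hp.out.ne_zero hpd h1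
  exact ⟨shaCorank_eq_zero_of_natCard_sha_torsionBy_eq_one W p h, h⟩

end Orders

/-! ## §4 Route readings -/

section Route

/-- **Granting T, one closed `ℚ`-door of `E` and one of `E^{(d_K)}` — at possibly DIFFERENT primes — square every descent
defect of `E_K`** (`K` quadratic): T moves both doors to every `q`, `t_q(E_K) = 0`, and the odd door over `K`.
[cite: Dokchitser2013ParityNotes, §2 and §4] [cite: Cassels1962ArithmeticIV, Thm. 1.1] -/
theorem isSquare_natCard_sha_torsionBy_baseChange_of_transfer (hT : FiniteShaComponentTransfer)
    (W : WeierstrassCurve ℚ) [W.IsElliptic] (K : Type) [Field K] [NumberField K] (h2 : Module.finrank ℚ K = 2)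
    (p p' : ℕ) [Fact p.Prime] [Fact p'.Prime] (hE : W.shaCorank p = 0)
    (hEd : (W.quadraticTwist (NumberField.discr K : ℚ)).shaCorank p' = 0) (q : ℕ) [Fact q.Prime] :
    IsSquare (Nat.card ((W.baseChange K).sha[(q : ℤ)])) := by
  have hd : ((NumberField.discr K : ℤ) : ℚ) ≠ 0 := by exact_mod_cast NumberField.discr_ne_zero K
  haveI : (W.quadraticTwist (NumberField.discr K : ℚ)).IsElliptic := W.isElliptic_quadraticTwist hd
  exact isSquare_natCard_sha_torsionBy_baseChange_of_doors W K q h2 (hT W p q hE)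
    (hT (W.quadraticTwist (NumberField.discr K : ℚ)) p' q hEd)

/-- **Granting T, a closed door of `E_L` over ANY number field squares every descent defect of `E` over `ℚ`.**
[cite: Cassels1962ArithmeticIV, Thm. 1.1] [cite: Darmon2004, Exercise 3.18] -/
theorem isSquare_natCard_sha_torsionBy_of_transfer_of_baseChange (hT : FiniteShaComponentTransfer)
    (W : WeierstrassCurve ℚ) [W.IsElliptic] (L : Type) [Field L] [NumberField L] (p : ℕ) [Fact p.Prime]
    (h0 : (W.baseChange L).shaCorank p = 0) (q : ℕ) [Fact q.Prime] : IsSquare (Nat.card (W.sha[(q : ℤ)])) :=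
  isSquare_natCard_sha_torsionBy_of_shaCorank_eq_zero W q
    (forall_shaCorank_eq_zero_of_transfer_of_baseChange hT W L p h0 q)

/-- **T's kill shape over a quadratic field — ONE base-changed curve suffices**: a closed door `t_p(E_K) = 0` together
with a NON-SQUARE `#Ш(E_K)[q]` refutes T = `FiniteShaComponentTransfer` (the closed door over `K` closes the `ℚ`-doors of
`E` and `E^{(d_K)}` at `p`; the non-square defect opens one of them at `q`). As over `ℚ`, this never fires under the
`p`-parity theorem. [cite: Dokchitser2013ParityNotes, §2 and §4] [cite: Cassels1962ArithmeticIV, Thm. 1.1] -/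
theorem not_finiteShaComponentTransfer_of_baseChange_witness (W : WeierstrassCurve ℚ) [W.IsElliptic] (K : Type)
    [Field K] [NumberField K] (h2 : Module.finrank ℚ K = 2) (p q : ℕ) [Fact p.Prime] [Fact q.Prime]
    (h0 : (W.baseChange K).shaCorank p = 0) (hq : ¬ IsSquare (Nat.card ((W.baseChange K).sha[(q : ℤ)]))) :
    ¬ FiniteShaComponentTransfer := by
  intro hT
  have hd : ((NumberField.discr K : ℤ) : ℚ) ≠ 0 := by exact_mod_cast NumberField.discr_ne_zero K
  haveI : (W.quadraticTwist (NumberField.discr K : ℚ)).IsElliptic := W.isElliptic_quadraticTwist hd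
  obtain ⟨hE, hEd⟩ := (shaCorank_baseChange_eq_zero_iff W K p h2).mp h0
  exact hq (isSquare_natCard_sha_torsionBy_baseChange_of_transfer hT W K h2 p p hE hEd q)

/-- **What a counterexample to T looks like over a quadratic field**: granting T, behind a closed door of `E_K` every
`q`-descent defect of `E_K`, of `E` and of `E^{(d_K)}` is a perfect square.
[cite: Dokchitser2013ParityNotes, §2 and §4] [cite: Cassels1962ArithmeticIV, Thm. 1.1] -/
theorem isSquare_defects_of_transfer_of_door_baseChange (hT : FiniteShaComponentTransfer) (W : WeierstrassCurve ℚ)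
    [W.IsElliptic] (K : Type) [Field K] [NumberField K] (h2 : Module.finrank ℚ K = 2) (p : ℕ) [Fact p.Prime]
    (h0 : (W.baseChange K).shaCorank p = 0) (q : ℕ) [Fact q.Prime] :
    IsSquare (Nat.card ((W.baseChange K).sha[(q : ℤ)])) ∧ IsSquare (Nat.card (W.sha[(q : ℤ)])) ∧
      IsSquare (Nat.card ((W.quadraticTwist (NumberField.discr K : ℚ)).sha[(q : ℤ)])) := by
  have hd : ((NumberField.discr K : ℤ) : ℚ) ≠ 0 := by exact_mod_cast NumberField.discr_ne_zero K
  haveI : (W.quadraticTwist (NumberField.discr K : ℚ)).IsElliptic := W.isElliptic_quadraticTwist hd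
  obtain ⟨hE, hEd, hK⟩ := forall_shaCorank_eq_zero_of_transfer_of_baseChange_quadratic hT W K h2 p h0 q
  haveI : (W.baseChange K).IsElliptic := by rw [WeierstrassCurve.baseChange]; infer_instance
  exact ⟨isSquare_natCard_sha_torsionBy_of_shaCorank_eq_zero (W.baseChange K) q hK,
    isSquare_natCard_sha_torsionBy_of_shaCorank_eq_zero W q hE,
    isSquare_natCard_sha_torsionBy_of_shaCorank_eq_zero (W.quadraticTwist (NumberField.discr K : ℚ)) q hEd⟩

end Route

end Summit.BirchSwinnertonDyer.BirchSwinnertonDyer.Theorems.ShaPrimaryTransferBaseChangeOddDoor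

end
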